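import Summits.QuantumFields.BalabanUV.Beta.StepResidualFM

/-!
# (J2), FIELD–FIELD BLOCK, paired with a source of BLOCK-CONSTANT codifferential: the step residual reproduces the source —
# `Σ_{(b,w)} a(b,w)·(bhKStep (j+1) ∘ KInvStep Lc (j+1))(x, w; inl κ, inl b) = a(κ, x)` (no gauge term for such sources)
# (β sub-cell, row BETA-an2 = BINDER-OWNERS row D1, gen 15; leaf L1.c-ff of `gen15/SKELETON-D1-hR.v2.1.md`, in the form (J3) consumes)

HONEST FRAMING (cell charter, verbatim): «discharging BetaPertH makes Balaban's UV stability UNCONDITIONAL — a real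
constructive-QFT result; it is NOT the continuum limit and NOT the Clay problem.»  DERIVED cell leaf (pub-balaban β sub-cell, lane
an2 gen 15); no statement of Bałaban's papers is typed here, no `[cite:]` tag, no `Prop` fact; it instantiates no binder of the
β-function wall by itself.  NOT `BetaPertH`; NOT continuum; NOT Clay.

## The mechanism (`M := Lc^{j+1}`, `N := Lc^{j+2} = M·Lc`; [folklore] throughout)

The field–field block of the step residual is NOT `1` entry by entry (a single covariance column carries a gauge multiplier); what the
absorption (J3) needs is its action on the ROWS of `Π_bm`, whose codifferential is block-constant (`GaugeMultiplierBlockMean`).  For a finite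
fine source `F` whose codifferential is block-constant at BOTH levels `M` and `N` the gauge multipliers of the covariance fields
`U_N = Σ F Γ_N`, `U_M = Σ F Γ_M` vanish (`McolSum_eq_zero_of_isBlockConst`), an5's two-level decomposition holds WITHOUT gauge term
(§1 `GcolSum_decomposition_of_isBlockConst`, an5's `GcolSum_decomposition` with the co-closedness hypothesis weakened — same pairing proof),
and differentiating it (`d*d`, §2) + the adjoint semigroup law + injectivity of `𝒬_Mᵀ` (`StepResidualFM`) give the step-lattice identity
§3 **`wΦ_M ⋆ (𝒬_M U_N) = 𝒬_{Lc}ᵀ Φ^{U_N} − Φ^{U_M}`**.  §4 reads the field–field row action of `bhKStep (j+1) ∘ KInvStep Lc (j+1)` against a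
step-lattice source `a` as exactly `M^{d+2}·[(wΦ_M ⋆ 𝒬_M U_N) − 𝒬_{Lc}ᵀ Φ^{U_N}]` for the LIFTED fine source `F = M^{−(d+2)}·𝒬_Mᵀ a`
(the column legs of `dec`), whose codifferential is automatically `M`-block-constant and is `N`-block-constant iff `codiff₁ a` is
`Lc`-block-constant; the surviving `−M^{d+2}·Φ^{U_M}` is `+Σ a·𝒬_M ℋ_M = a` (`GamΦ_eq_neg_wH`, `contourSum_Hcol`):
**`sum_mul_comp_bhKStep_KInvStep_inl_inl`**.  NOT the entrywise (ff) block; exactly what (J3) uses.  All declarations `[folklore]`;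
axioms standard.  Provenance: b2b-balaban β sub-cell, unit beta-an2 gen 15, 2026-08-20 (v1); §1 is ADAPTED from an5's
`ResolventComposition.GcolSum_decomposition` (proof copied with one hypothesis swapped; credited); over `StepResidualFM`, `GaugeMultiplierBlockMean`
BY NAME; no existing file touched.
-/

open Finset
open scoped BigOperators
open Literature.Probability.LatticeModels (TorusSite Torus.proj Torus.proj_apply)
open Literature.MathematicalPhysics.QuantumFieldTheory
open Literature.MathematicalPhysics.QuantumFieldTheory.Balaban1983to89
open Literature.MathematicalPhysics.QuantumFieldTheory.Balaban1983to89.Beta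
open B12Sec2to5 (l1 l1_nonneg Decay510)
open ExpKernelCalculus (MKer Decays comp)
open AffineAveraging (Form0 Form1 Form2 box toSite unitVec unitVec_apply dz curv curvAdj codiff₁ contourSum blockSum)
open AffineReproduction (contourSumAdj IsBlockConst)
open KKTFluctuationKernel (delta1 delta1_apply Gam GamΦ GamM Gam_Q GamM_M)
open KKTFluctuationEnergy (lip0 lip1 lip2 lip2_comm lip1_add lip1_curvAdj lip1_dz lip0_codiff₁ lip1_contourSumAdj abs_contourSumAdj_le
  abs_dz_le abs_codiff₁_le summable_dz summable_codiff₁ summable_curv summable_mul_of_bdd summable_mul_of_bdd' contourSumAdj_eq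
  tsum_mul_eq_zero_of_blockConst Gcol Mcol Φcol δcol curvAdj_curv_Gcol Gcol_bdd_summable Mcol_bdd_summable Φcol_bdd GcolSum)
open KKTFluctuationUnique (abs_le_of_decay510)
open DecimatedMomentLimit (summable_of_decay510)
open KernelSpecInstance (wH wΦ decay_wΦ opEL hasSum_curv hasSum_curvAdj op₁₁_superpos)
open LatticeForm (quo)
open OneStepResolventKernel (Fib KInv KInv_inl_inl KInv_inr_inl_coarse KInv_inr_inr_coarse quo_zsmul eq_zsmul_quo_of_proj proj_zsmul)
open OneStepKernelFamily (KInvStep dec legSet legW legPt LegIdx)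
open StepDriftWitness (sum_LegIdx_eq_contourSum)
open ResolventComposition (δSum McolSum ΦcolSum curvAdj_curv_GcolSum GcolSum_bdd_summable isBlockConst_GcolSum lip1_Gcol_δSum
  abs_δSum_le isBlockConst_of_mul GamΦ_eq_neg_wH codiff₁_contourSumAdj Hcol Hcol_apply HΦcol HΦcol_apply contourSum_Hcol
  curvAdj_curv_Hcol Hcol_bdd_summable HΦcol_bdd KInvStep_inl_inr contourSum_mul wH_reproduction summable_wH_sub_zsmul zsmul_pow_succ
  exists_abs_KInvStep_le)
open ResolventCompositionStepB (abs_contourSum_le)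
open BalabanCompositeJets (summable_contourSum)
open BalabanStepJetsSucc (E2 wVH)
open Summit.QuantumFields.BalabanUV.Beta.TameKernelCalculus
open Summit.QuantumFields.BalabanUV.Beta.AxialDressingRooted (KInvStep_inr_off' one_le_of_neZero)

namespace Summit.QuantumFields.BalabanUV.Beta.BorderedHessian

noncomputable section

variable {d : ℕ}

/-! ## §1 an5's two-level decomposition for forces with block-constant codifferential -/

section Decomposition

variable {N : ℕ} [NeZero N]

/-- [folklore] (EL) of a finite combination of covariance columns WITHOUT gauge term when the codifferential of its force is
block-constant (`McolSum_eq_zero_of_isBlockConst`). -/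
theorem curvAdj_curv_GcolSum_of_isBlockConst (S : Finset (Fin (d + 1) × AffineAveraging.Site (d + 1)))
    (a : Fin (d + 1) × AffineAveraging.Site (d + 1) → ℝ) (hbc : IsBlockConst N (codiff₁ (δSum S a))) :
    curvAdj (curv (GcolSum (N := N) S a)) = contourSumAdj N (ΦcolSum (N := N) S a) + δSum S a := by
  rw [curvAdj_curv_GcolSum, McolSum_eq_zero_of_isBlockConst (N := N) S a hbc]
  have h0 : dz (codiff₁ (dz (0 : Form0 (d + 1) ℝ))) = 0 := by
    funext κ x
    simp [dz, codiff₁]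
  rw [h0, add_zero]

/-- [folklore] **THE TWO-LEVEL DECOMPOSITION FOR A FORCE WITH `N′`-BLOCK-CONSTANT CODIFFERENTIAL** (`N′ = ML`):
`U_{N′} = U_M + Σ_{(l″, w′)} (𝒬_M U_{N′})(l″, w′) · ℋ_M(·; l″, w′)` — an5's `ResolventComposition.GcolSum_decomposition` VERBATIM with
its co-closedness hypothesis weakened to block-constancy (the proof is an5's pairing proof, unchanged but for the Euler–Lagrange input). -/
theorem GcolSum_decomposition_of_isBlockConst {N' M L : ℕ} [NeZero N'] [NeZero M] [NeZero L] (hN : N' = M * L)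
    (S : Finset (Fin (d + 1) × AffineAveraging.Site (d + 1))) (a : Fin (d + 1) × AffineAveraging.Site (d + 1) → ℝ)
    (hbc : IsBlockConst N' (codiff₁ (δSum S a))) (κ₀ : Fin (d + 1)) (x₀ : AffineAveraging.Site (d + 1)) :
    GcolSum (N := N') S a κ₀ x₀
      = GcolSum (N := M) S a κ₀ x₀ + ∑' w' : (Fin (d + 1) → ℤ), ∑ l'' : Fin (d + 1),
          contourSum M (GcolSum (N := N') S a) l'' w' * wH (N := M) (d := d) κ₀ l'' (x₀ - (M : ℤ) • w') := by
  -- adapted from Literature/…/Beta/ResolventComposition.lean `GcolSum_decomposition` (an5), hypothesis `hco` ↦ `hbc`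
  subst hN
  obtain ⟨K, hUb, hUs, hΦUb, _, _⟩ := GcolSum_bdd_summable (N := M * L) S a
  have hELU := curvAdj_curv_GcolSum_of_isBlockConst (N := M * L) S a hbc
  have hGU := isBlockConst_GcolSum (N := M * L) S a
  set U : Form1 (d + 1) ℝ := GcolSum (N := M * L) S a with hUdef
  obtain ⟨C, _, hbdd, hsum⟩ := Gcol_bdd_summable (N := M) (d := d)
  obtain ⟨CM, _, hMb, hMs⟩ := Mcol_bdd_summable (N := M) (d := d)
  obtain ⟨CΦ, _, hΦ⟩ := Φcol_bdd (N := M) (d := d)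
  have hM : 0 < M := Nat.pos_of_ne_zero (NeZero.ne M)
  have sQ : ∀ μ', Summable (fun x => Gcol (N := M) κ₀ x₀ μ' x * contourSumAdj (M * L) (ΦcolSum (N := M * L) S a) μ' x) :=
    fun μ' => summable_mul_of_bdd' (hsum κ₀ x₀ μ') (fun x => abs_contourSumAdj_le hΦUb μ' x)
  have sδ : ∀ μ', Summable (fun x => Gcol (N := M) κ₀ x₀ μ' x * δSum S a μ' x) :=
    fun μ' => summable_mul_of_bdd' (hsum κ₀ x₀ μ') (abs_δSum_le S a μ')
  have hP0 : lip1 U (curvAdj (curv (Gcol (N := M) κ₀ x₀))) = GcolSum (N := M) S a κ₀ x₀ := by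
    rw [lip1_curvAdj hUb (fun κ l => summable_curv (hsum κ₀ x₀) κ l), lip2_comm,
      ← lip1_curvAdj (hbdd κ₀ x₀) (fun κ l => summable_curv hUs κ l), hELU, lip1_add sQ sδ,
      lip1_contourSumAdj (N := M * L) (hsum κ₀ x₀) hΦUb, lip1_Gcol_δSum]
    have hz : ∑' y, ∑ κ, ΦcolSum (N := M * L) S a κ y * contourSum (M * L) (Gcol (N := M) κ₀ x₀) κ y = 0 := by
      refine (tsum_congr fun y => ?_).trans tsum_zero
      refine Finset.sum_eq_zero fun κ _ => ?_
      have h0 : contourSum M (Gcol (N := M) κ₀ x₀) = 0 := by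
        funext κ' y'
        exact Gam_Q (N := M) κ₀ x₀ κ' y'
      have hQ : contourSum (M * L) (Gcol (N := M) κ₀ x₀) κ y = 0 := by
        rw [contourSum_mul M L hM, h0]
        simp [contourSum]
      rw [hQ, mul_zero]
    rw [hz, zero_add]
  have h1 : lip1 U (contourSumAdj M (Φcol (N := M) κ₀ x₀))
      = -∑' w' : (Fin (d + 1) → ℤ), ∑ l'' : Fin (d + 1),
          contourSum M U l'' w' * wH (N := M) (d := d) κ₀ l'' (x₀ - (M : ℤ) • w') := by
    rw [lip1_contourSumAdj (N := M) hUs (hΦ κ₀ x₀), ← tsum_neg]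
    refine tsum_congr fun w' => ?_
    rw [← Finset.sum_neg_distrib]
    refine Finset.sum_congr rfl fun l'' _ => ?_
    rw [show Φcol (N := M) κ₀ x₀ l'' w' = GamΦ (N := M) l'' w' κ₀ x₀ from rfl, GamΦ_eq_neg_wH]
    ring
  have h2 : lip1 U (dz (codiff₁ (dz (Mcol (N := M) κ₀ x₀)))) = 0 := by
    have e1 : ∀ x, |codiff₁ U x| ≤ (d + 1 : ℕ) * (2 * K) := fun x => abs_codiff₁_le hUb x
    have e2 : ∀ κ x, |dz (codiff₁ U) κ x| ≤ 2 * ((d + 1 : ℕ) * (2 * K)) := fun κ x => abs_dz_le e1 κ x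
    have e3 : ∀ x, |codiff₁ (dz (codiff₁ U)) x| ≤ (d + 1 : ℕ) * (2 * (2 * ((d + 1 : ℕ) * (2 * K)))) :=
      fun x => abs_codiff₁_le e2 x
    have hdzM : ∀ κ, Summable (dz (Mcol (N := M) κ₀ x₀) κ) := fun κ => summable_dz (hMs κ₀ x₀) κ
    rw [lip1_dz hUb (summable_codiff₁ hdzM), lip0_codiff₁ e1 hdzM, lip1_dz e2 (hMs κ₀ x₀)]
    exact tsum_mul_eq_zero_of_blockConst (N := M) e3 (isBlockConst_of_mul hGU) (hMs κ₀ x₀) (GamM_M (N := M) κ₀ x₀)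
  have h3 : lip1 U (δcol κ₀ x₀) = U κ₀ x₀ := by
    unfold KKTFluctuationEnergy.lip1
    have e : ∀ x, ∑ μ' : Fin (d + 1), U μ' x * δcol κ₀ x₀ μ' x = if x = x₀ then U κ₀ x₀ else 0 := by
      intro x
      by_cases hx : x = x₀
      · subst hx
        simp [δcol]
      · simp [δcol, hx]
    rw [tsum_congr e, tsum_eq_single x₀ (fun x hx => if_neg hx), if_pos rfl]
  have sT1 : ∀ μ', Summable (fun x => U μ' x * contourSumAdj M (Φcol (N := M) κ₀ x₀) μ' x) :=
    fun μ' => summable_mul_of_bdd' (hUs μ') (fun x => abs_contourSumAdj_le (hΦ κ₀ x₀) μ' x)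
  have hT2b : ∀ μ' x, |dz (codiff₁ (dz (Mcol (N := M) κ₀ x₀))) μ' x| ≤ 2 * ((d + 1 : ℕ) * (2 * (2 * CM))) := fun μ' x =>
    abs_dz_le (fun z => abs_codiff₁_le (fun κ w => abs_dz_le (hMb κ₀ x₀) κ w) z) μ' x
  have sT2 : ∀ μ', Summable (fun x => U μ' x * dz (codiff₁ (dz (Mcol (N := M) κ₀ x₀))) μ' x) :=
    fun μ' => summable_mul_of_bdd' (hUs μ') (hT2b μ')
  have sδ' : ∀ μ', Summable (fun x => U μ' x * δcol κ₀ x₀ μ' x) := fun μ' =>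
    summable_mul_of_bdd' (M := 1) (hUs μ') (fun x => by
      unfold KKTFluctuationEnergy.δcol
      split_ifs <;> simp)
  have s12 : ∀ μ', Summable (fun x => U μ' x
      * (contourSumAdj M (Φcol (N := M) κ₀ x₀) + dz (codiff₁ (dz (Mcol (N := M) κ₀ x₀)))) μ' x) := fun μ' => by
    have h := (sT1 μ').add (sT2 μ')
    simpa only [Pi.add_apply, mul_add] using h
  have hP : lip1 U (curvAdj (curv (Gcol (N := M) κ₀ x₀)))
      = -(∑' w' : (Fin (d + 1) → ℤ), ∑ l'' : Fin (d + 1),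
          contourSum M U l'' w' * wH (N := M) (d := d) κ₀ l'' (x₀ - (M : ℤ) • w')) + 0 + U κ₀ x₀ := by
    rw [curvAdj_curv_Gcol, lip1_add s12 sδ', lip1_add sT1 sT2, h1, h2, h3]
  rw [hP0] at hP
  linarith

end Decomposition

/-! ## §2 The decomposition differentiated: `𝒬_Nᵀ Φ^{U_N} = 𝒬_Mᵀ Φ^{U_M} + 𝒬_Mᵀ (wΦ_M ⋆ 𝒬_M U_N)` pointwise -/

section Differentiated

variable {N M L : ℕ} [NeZero N] [NeZero M] [NeZero L]

/-- [folklore] The decomposition as a pointwise `HasSum` of 1-forms: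
`Σ_{w′} Σ_{l″} ℋ_M(·; l″,w′)·(𝒬_M U_N)(l″,w′) = U_N − U_M`. -/
theorem hasSum_GcolSum_decomposition (hN : N = M * L) (S : Finset (Fin (d + 1) × AffineAveraging.Site (d + 1)))
    (a : Fin (d + 1) × AffineAveraging.Site (d + 1) → ℝ) (hbc : IsBlockConst N (codiff₁ (δSum S a)))
    (κ : Fin (d + 1)) (x : Fin (d + 1) → ℤ) :
    HasSum (fun w' : Fin (d + 1) → ℤ => ∑ l'' : Fin (d + 1),
        Hcol (N := M) l'' w' κ x * contourSum M (GcolSum (N := N) S a) l'' w')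
      (GcolSum (N := N) S a κ x - GcolSum (N := M) S a κ x) := by
  obtain ⟨K, hUb, hUs, -, -, -⟩ := GcolSum_bdd_summable (N := N) S a
  have hc : ∀ l w, |contourSum M (GcolSum (N := N) S a) l w| ≤ (box (d + 1) M).card * (M * K) :=
    fun l w => abs_contourSum_le hUb l w
  have hs : Summable (fun w' : Fin (d + 1) → ℤ => ∑ l'' : Fin (d + 1),
      contourSum M (GcolSum (N := N) S a) l'' w' * wH (N := M) κ l'' (x - (M : ℤ) • w')) :=
    summable_sum fun l'' _ => summable_mul_of_bdd (fun w' => hc l'' w') (summable_wH_sub_zsmul M κ l'' x)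
  have h := hs.hasSum
  have hdec := GcolSum_decomposition_of_isBlockConst hN S a hbc κ x
  rw [show (∑' w' : Fin (d + 1) → ℤ, ∑ l'' : Fin (d + 1),
      contourSum M (GcolSum (N := N) S a) l'' w' * wH (N := M) κ l'' (x - (M : ℤ) • w')) =
      GcolSum (N := N) S a κ x - GcolSum (N := M) S a κ x by linarith] at h
  have e : (fun w' : Fin (d + 1) → ℤ => ∑ l'' : Fin (d + 1), Hcol (N := M) l'' w' κ x * contourSum M (GcolSum (N := N) S a) l'' w') =
      fun w' => ∑ l'' : Fin (d + 1), contourSum M (GcolSum (N := N) S a) l'' w' * wH (N := M) κ l'' (x - (M : ℤ) • w') := by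
    funext w'
    exact Finset.sum_congr rfl fun l'' _ => by rw [Hcol_apply, mul_comm]
  rw [e]
  exact h

/-- [folklore] **THE DECOMPOSITION DIFFERENTIATED** (force with block-constant codifferential at BOTH levels):
`HasSum (w′ ↦ Σ_{l″} (𝒬_M U_N)(l″,w′)·(𝒬_Mᵀ Φ^ℋ_M(·; l″,w′))_μ(y)) ((𝒬_Nᵀ Φ^{U_N})_μ(y) − (𝒬_Mᵀ Φ^{U_M})_μ(y))`. -/
theorem hasSum_GcolSum_decomposition_EL (hN : N = M * L) (S : Finset (Fin (d + 1) × AffineAveraging.Site (d + 1)))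
    (a : Fin (d + 1) × AffineAveraging.Site (d + 1) → ℝ) (hbcN : IsBlockConst N (codiff₁ (δSum S a)))
    (hbcM : IsBlockConst M (codiff₁ (δSum S a))) (μ : Fin (d + 1)) (y : Fin (d + 1) → ℤ) :
    HasSum (fun w' : Fin (d + 1) → ℤ => ∑ l'' : Fin (d + 1),
        contourSum M (GcolSum (N := N) S a) l'' w' * contourSumAdj M (HΦcol (N := M) l'' w') μ y)
      (contourSumAdj N (ΦcolSum (N := N) S a) μ y - contourSumAdj M (ΦcolSum (N := M) S a) μ y) := by
  have h0 : ∀ κ x, HasSum (fun w' : Fin (d + 1) → ℤ => (fun κ x => ∑ l'' : Fin (d + 1),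
      Hcol (N := M) l'' w' κ x * contourSum M (GcolSum (N := N) S a) l'' w') κ x)
      ((GcolSum (N := N) S a - GcolSum (N := M) S a) κ x) :=
    fun κ x => hasSum_GcolSum_decomposition hN S a hbcN κ x
  have h1 := hasSum_curv h0
  have h2 := hasSum_curvAdj h1 μ y
  have hsub : curvAdj (curv (GcolSum (N := N) S a - GcolSum (N := M) S a)) μ y =
      contourSumAdj N (ΦcolSum (N := N) S a) μ y - contourSumAdj M (ΦcolSum (N := M) S a) μ y := by
    have e : GcolSum (N := N) S a - GcolSum (N := M) S a = GcolSum (N := N) S a + (-1 : ℝ) • GcolSum (N := M) S a := by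
      funext κ x; simp [sub_eq_add_neg]
    rw [e, show curvAdj (curv (GcolSum (N := N) S a + (-1 : ℝ) • GcolSum (N := M) S a)) =
      opEL (GcolSum (N := N) S a + (-1 : ℝ) • GcolSum (N := M) S a) from rfl, map_add, map_smul,
      show opEL (GcolSum (N := N) S a) = curvAdj (curv (GcolSum (N := N) S a)) from rfl,
      show opEL (GcolSum (N := M) S a) = curvAdj (curv (GcolSum (N := M) S a)) from rfl,
      curvAdj_curv_GcolSum_of_isBlockConst (N := N) S a hbcN, curvAdj_curv_GcolSum_of_isBlockConst (N := M) S a hbcM]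
    simp only [Pi.add_apply, Pi.smul_apply, smul_eq_mul]
    ring
  rw [hsub] at h2
  have e : ∀ w' : Fin (d + 1) → ℤ, curvAdj (curv (fun κ x => ∑ l'' : Fin (d + 1),
      Hcol (N := M) l'' w' κ x * contourSum M (GcolSum (N := N) S a) l'' w')) μ y =
      ∑ l'' : Fin (d + 1), contourSum M (GcolSum (N := N) S a) l'' w' * contourSumAdj M (HΦcol (N := M) l'' w') μ y := by
    intro w'
    have h := op₁₁_superpos opEL (fun l'' => Hcol (N := M) l'' w') (fun l'' => contourSum M (GcolSum (N := N) S a) l'' w') μ y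
    rw [show opEL (fun κ z => ∑ l'' : Fin (d + 1), Hcol (N := M) l'' w' κ z * contourSum M (GcolSum (N := N) S a) l'' w') =
      curvAdj (curv (fun κ x => ∑ l'' : Fin (d + 1), Hcol (N := M) l'' w' κ x * contourSum M (GcolSum (N := N) S a) l'' w'))
      from rfl] at h
    rw [h]
    exact Finset.sum_congr rfl fun l'' _ => by
      rw [show opEL (Hcol (N := M) l'' w') = curvAdj (curv (Hcol (N := M) l'' w')) from rfl, curvAdj_curv_Hcol]
  simp_rw [e] at h2
  exact h2

end Differentiated

/-! ## §3 The step-lattice identity `wΦ_M ⋆ (𝒬_M U_N) = 𝒬_Lᵀ Φ^{U_N} − Φ^{U_M}` -/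

section StepIdentity

variable {N M L : ℕ} [NeZero N] [NeZero M] [NeZero L]

/-- [folklore] **THE VALUE HESSIAN ON THE BLOCK AVERAGES OF A FINE COVARIANCE FIELD WITH BLOCK-CONSTANT-CODIFFERENTIAL FORCE**:
`Σ′_{w′} Σ_{l″} (𝒬_M U_N)(l″, w′) · wΦ_M κ l″ (x − w′) = (𝒬_Lᵀ Φ^{U_N})_κ(x) − Φ^{U_M}_κ(x)` on the whole `M`-step lattice. -/
theorem tsum_contourSum_GcolSum_mul_wΦ (hN : N = M * L) (S : Finset (Fin (d + 1) × AffineAveraging.Site (d + 1)))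
    (a : Fin (d + 1) × AffineAveraging.Site (d + 1) → ℝ) (hbcN : IsBlockConst N (codiff₁ (δSum S a)))
    (hbcM : IsBlockConst M (codiff₁ (δSum S a))) (κ : Fin (d + 1)) (x : Fin (d + 1) → ℤ) :
    ∑' w' : Fin (d + 1) → ℤ, ∑ l'' : Fin (d + 1), contourSum M (GcolSum (N := N) S a) l'' w' * wΦ (N := M) κ l'' (x - w') =
      contourSumAdj L (ΦcolSum (N := N) S a) κ x - ΦcolSum (N := M) S a κ x := by
  obtain ⟨K, hUb, hUs, hΦUb, -, -⟩ := GcolSum_bdd_summable (N := N) S a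
  obtain ⟨KM, -, -, hΦUMb, -, -⟩ := GcolSum_bdd_summable (N := M) S a
  obtain ⟨CΦ, hΦ⟩ := exists_abs_wΦ_le (N := M) (d := d)
  have hcs : ∀ l, Summable (contourSum M (GcolSum (N := N) S a) l) := fun l => summable_contourSum M hUs l
  set ψ₁ : Form1 (d + 1) ℝ := fun κ x => ∑' w' : Fin (d + 1) → ℤ, ∑ l'' : Fin (d + 1),
    contourSum M (GcolSum (N := N) S a) l'' w' * wΦ (N := M) κ l'' (x - w') with hψ₁def
  have hs1 : ∀ κ x, Summable (fun w' : Fin (d + 1) → ℤ => ∑ l'' : Fin (d + 1),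
      contourSum M (GcolSum (N := N) S a) l'' w' * wΦ (N := M) κ l'' (x - w')) :=
    fun κ x => summable_sum fun l'' _ => summable_mul_of_bdd' (hcs l'') (fun w' => hΦ κ l'' _)
  have hs2 : Summable (fun w' : Fin (d + 1) → ℤ => ∑ l'' : Fin (d + 1), |contourSum M (GcolSum (N := N) S a) l'' w'| * CΦ) :=
    summable_sum fun l'' _ => (hcs l'').abs.mul_right CΦ
  have hterm : ∀ κ x (w' : Fin (d + 1) → ℤ), |∑ l'' : Fin (d + 1), contourSum M (GcolSum (N := N) S a) l'' w' * wΦ (N := M) κ l'' (x - w')| ≤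
      ∑ l'' : Fin (d + 1), |contourSum M (GcolSum (N := N) S a) l'' w'| * CΦ := fun κ x w' =>
    (Finset.abs_sum_le_sum_abs _ _).trans (Finset.sum_le_sum fun l'' _ => by
      rw [abs_mul]; exact mul_le_mul_of_nonneg_left (hΦ κ l'' _) (abs_nonneg _))
  have hψ₁ : ∀ κ x, |ψ₁ κ x| ≤ ∑' w' : Fin (d + 1) → ℤ, ∑ l'' : Fin (d + 1), |contourSum M (GcolSum (N := N) S a) l'' w'| * CΦ := by
    intro κ x
    rw [abs_le]
    constructor
    · rw [← tsum_neg]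
      exact Summable.tsum_le_tsum (fun w' => (abs_le.mp (hterm κ x w')).1) hs2.neg (hs1 κ x)
    · exact Summable.tsum_le_tsum (fun w' => (abs_le.mp (hterm κ x w')).2) (hs1 κ x) hs2
  have hψ₂ : ∀ κ x, |(contourSumAdj L (ΦcolSum (N := N) S a) - ΦcolSum (N := M) S a) κ x| ≤ L * K + KM := by
    intro κ x
    rw [Pi.sub_apply, Pi.sub_apply]
    exact (abs_sub _ _).trans (add_le_add (abs_contourSumAdj_le hΦUb κ x) (hΦUMb κ x))
  suffices h : contourSumAdj M ψ₁ = contourSumAdj M (contourSumAdj L (ΦcolSum (N := N) S a) - ΦcolSum (N := M) S a) by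
    have := congrFun (congrFun (eq_of_contourSumAdj_eq (M := M) hψ₁ hψ₂ h) κ) x
    rw [Pi.sub_apply, Pi.sub_apply] at this
    exact this
  have hlin : contourSumAdj M (contourSumAdj L (ΦcolSum (N := N) S a) - ΦcolSum (N := M) S a) =
      contourSumAdj M (contourSumAdj L (ΦcolSum (N := N) S a)) - contourSumAdj M (ΦcolSum (N := M) S a) := by
    funext μ y
    simp only [contourSumAdj_eq, Pi.sub_apply, Finset.sum_sub_distrib]
  rw [hlin, ← contourSumAdj_mul M L hΦUb, ← hN]
  funext μ y
  rw [Pi.sub_apply]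
  refine Eq.trans ?_ (hasSum_GcolSum_decomposition_EL hN S a hbcN hbcM μ y).tsum_eq
  rw [contourSumAdj_eq]
  have hsum : ∀ s : ℕ, Summable (fun w' : Fin (d + 1) → ℤ => ∑ l'' : Fin (d + 1),
      contourSum M (GcolSum (N := N) S a) l'' w' * wΦ (N := M) μ l'' (quo M (y - (s : ℤ) • unitVec μ) - w')) :=
    fun s => hs1 μ _
  rw [← Summable.tsum_finsetSum (fun s _ => hsum s)]
  refine tsum_congr fun w' => ?_
  rw [Finset.sum_comm]
  refine Finset.sum_congr rfl fun l'' _ => ?_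
  rw [contourSumAdj_eq, Finset.mul_sum]
  simp only [HΦcol_apply]

end StepIdentity

end

end Summit.QuantumFields.BalabanUV.Beta.BorderedHessian
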